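import Mathlib.MeasureTheory.Function.Jacobian
import Literature.NumberTheory.Transcendental.KZCalculus
import Literature.NumberTheory.Transcendental.KZDominatedFamilyRelations
import Literature.NumberTheory.Transcendental.SemialgebraicMapsProofs

/-!
# `BetaCancellation` (stmt-KontsevichZagierPeriods-13633), line `dirichlet-companion-to-pi` — stub `stub_equivalent_of_aeJacobian`

**From an almost-everywhere Jacobian identity to one move of the calculus.** Let `r`, `r'` be
integral representations of dimension `n` (`σ = r.domain`, `f = r.integrand`, `f' = r'.integrand`),
and let `ψ` be a `ℚ`-semialgebraic substitution on `σ`, injective on `σ`, with a derivative `ψ' w`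
within `σ` at every `w ∈ σ`, such that `r'.domain = ψ '' σ`, the Jacobian `w ↦ |det ψ' w|` is
`ℚ`-semialgebraic on `σ`, and the rule-(2) identity `f w = f' (ψ w) · |det ψ' w|` holds for ALMOST
EVERY `w ∈ σ`. Then `r ∼ r'` (`KZ.Equivalent r r'`).

Proof. The good set `E = {w ∈ σ | f w = f' (ψ w) · |det ψ' w|}` is `ℚ`-semialgebraic: `f' ∘ ψ` is
semialgebraic on `σ` (`IsSemialgebraicFunOn.comp_isSemialgebraicMapOn_holds`), so is the product with
the Jacobian (`IsSemialgebraicFunOn.mul_holds`), and equalisers of semialgebraic functions are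
semialgebraic (`isSemialgebraic_sep_eq`, Tarski–Seidenberg). By hypothesis `σ ∖ E` is null, so
`[r] ≡ [r|_E]` (`KZ.IntegralRep.of_sub_of_restrict_mem_relations`). The image `ψ '' E ⊆ r'.domain` is
`ℚ`-semialgebraic (`IsSemialgebraicMapOn.isSemialgebraic_image_holds`), and `[r|_E] − [r'|_{ψ E}]` is
literally ONE change-of-variables generator (`KZ.changeOfVariablesRel`: on `E` the Jacobian identity
holds pointwise). Finally `r'.domain ∖ ψ '' E ⊆ ψ '' (σ ∖ E)` is null by the area inequality
`MeasureTheory.addHaar_image_le_lintegral_abs_det_fderiv` (the integral over the null set `σ ∖ E`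
vanishes), so `[r'] ≡ [r'|_{ψ E}]`, and the three relations combine. No definitions; sorry-free;
axioms ⊆ {propext, Classical.choice, Quot.sound}.

References: M. Kontsevich, D. Zagier, *Periods* (2001), §1.2 rules (1)–(2); J. Bochnak, M. Coste,
M.-F. Roy, *Real Algebraic Geometry* (1998), Thm. 2.2.1, Prop. 2.2.6–2.2.7.
-/

noncomputable section

-- `Summit.KontsevichZagierPeriods.KontsevichZagierPeriods.…` is the tree's mandated layout (single-conjunct summit).
set_option linter.dupNamespace false

namespace Summit.KontsevichZagierPeriods.KontsevichZagierPeriods.BetaCancellationLine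

open MeasureTheory Set
open Literature.NumberTheory.Transcendental
open Literature.NumberTheory.Transcendental.KZ

/-! ### The good set of an a.e. Jacobian identity -/

/-- The good set `{w ∈ σ | f w = f' (ψ w) · |det ψ' w|}` of the rule-(2) identity is
`ℚ`-semialgebraic when `σ`, `f`, `f'` (on `r'.domain ⊇ ψ σ`), `ψ` and `|det ψ'|` are: composition,
product and equaliser of semialgebraic functions (Tarski–Seidenberg).
[cite: BochnakCosteRoy1998, Prop. 2.2.6] -/
theorem aeJacobian_isSemialgebraic_goodSet {n : ℕ} (r r' : IntegralRep n)
    (ψ : (Fin n → ℝ) → (Fin n → ℝ)) (ψ' : (Fin n → ℝ) → (Fin n → ℝ) →L[ℝ] (Fin n → ℝ))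
    (hψsa : IsSemialgebraicMapOn ℚ r.domain ψ) (hmaps : MapsTo ψ r.domain r'.domain)
    (hdet : IsSemialgebraicFunOn ℚ r.domain fun w => |(ψ' w).det|) :
    Literature.ModelTheory.ExponentialFields.IsSemialgebraic ℚ
      {w | w ∈ r.domain ∧ r.integrand w = r'.integrand (ψ w) * |(ψ' w).det|} := by
  have hcomp : IsSemialgebraicFunOn ℚ r.domain (r'.integrand ∘ ψ) :=
    IsSemialgebraicFunOn.comp_isSemialgebraicMapOn_holds r'.isSemialgebraicFunOn_integrand hψsa
      hmaps
  have hprod : IsSemialgebraicFunOn ℚ r.domain ((r'.integrand ∘ ψ) * fun w => |(ψ' w).det|) :=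
    IsSemialgebraicFunOn.mul_holds hcomp hdet
  exact isSemialgebraic_sep_eq r.isSemialgebraicFunOn_integrand hprod

/-- The image of a null measurable subset `N ⊆ σ` under a map with a derivative within `σ` at every
point of `σ` is null: the area inequality `vol (ψ N) ≤ ∫_N |det ψ'|` over a null set.
[cite: KontsevichZagier2001, §1.2 rule (2)] -/
theorem aeJacobian_volume_image_null {n : ℕ} {σ N : Set (Fin n → ℝ)}
    (ψ : (Fin n → ℝ) → (Fin n → ℝ)) (ψ' : (Fin n → ℝ) → (Fin n → ℝ) →L[ℝ] (Fin n → ℝ))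
    (hψ' : ∀ w ∈ σ, HasFDerivWithinAt ψ (ψ' w) σ w) (hNσ : N ⊆ σ) (hN : MeasurableSet N)
    (hvol : volume N = 0) : volume (ψ '' N) = 0 := by
  have hle := addHaar_image_le_lintegral_abs_det_fderiv volume hN
    (fun w hw => (hψ' w (hNσ hw)).mono hNσ)
  rw [setLIntegral_measure_zero _ _ hvol] at hle
  exact nonpos_iff_eq_zero.mp hle

/-! ### The stub -/

/-- STUB `stub_equivalent_of_aeJacobian` (calculus bookkeeping, seat c14). If `ψ` is a
`ℚ`-semialgebraic injective substitution on `r.domain` with derivative `ψ'` within it,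
`r'.domain = ψ '' r.domain`, the Jacobian `|det ψ'|` is `ℚ`-semialgebraic on `r.domain`, and the
rule-(2) identity `f = (f' ∘ ψ) · |det ψ'|` holds ALMOST EVERYWHERE on `r.domain`, then `r ∼ r'`:
the good set `E` is `ℚ`-semialgebraic with null complement, so `r` is equivalent to its restriction
to `E` (`IntegralRep.of_sub_of_restrict_mem_relations`), that restriction is ONE change-of-variables
move onto `r'` restricted to `ψ '' E`, and `r'.domain ∖ ψ '' E ⊆ ψ '' (r.domain ∖ E)` is null by the
area inequality `MeasureTheory.addHaar_image_le_lintegral_abs_det_fderiv`.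
[cite: KontsevichZagier2001, §1.2 rule (2)] -/
theorem stub_equivalent_of_aeJacobian {n : ℕ} (r r' : IntegralRep n)
    (ψ : (Fin n → ℝ) → (Fin n → ℝ)) (ψ' : (Fin n → ℝ) → (Fin n → ℝ) →L[ℝ] (Fin n → ℝ))
    (hψsa : IsSemialgebraicMapOn ℚ r.domain ψ)
    (hψ' : ∀ w ∈ r.domain, HasFDerivWithinAt ψ (ψ' w) r.domain w) (hψinj : Set.InjOn ψ r.domain)
    (himg : r'.domain = ψ '' r.domain)
    (hdet : IsSemialgebraicFunOn ℚ r.domain fun w => |(ψ' w).det|)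
    (hae : ∀ᵐ w ∂(MeasureTheory.volume.restrict r.domain),
      r.integrand w = r'.integrand (ψ w) * |(ψ' w).det|) :
    Equivalent r r' := by
  -- the good set `E` and its basic properties
  set E : Set (Fin n → ℝ) :=
    {w | w ∈ r.domain ∧ r.integrand w = r'.integrand (ψ w) * |(ψ' w).det|} with hE_def
  have hmaps : MapsTo ψ r.domain r'.domain := by
    rw [himg]
    exact mapsTo_image ψ r.domain
  have hE : Literature.ModelTheory.ExponentialFields.IsSemialgebraic ℚ E :=
    aeJacobian_isSemialgebraic_goodSet r r' ψ ψ' hψsa hmaps hdet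
  have hEσ : E ⊆ r.domain := fun w hw => hw.1
  have hσm : MeasurableSet r.domain := IntegralRep.measurableSet_domain_holds r
  have hvol : volume (r.domain \ E) = 0 := by
    rw [measure_eq_zero_iff_ae_notMem]
    rw [ae_restrict_iff' hσm] at hae
    filter_upwards [hae] with w hw hmem
    exact hmem.2 ⟨hmem.1, hw hmem.1⟩
  -- (3) `[r] ≡ [r|_E]`
  have h₁ : of r - of (r.restrict E hE hEσ) ∈ relations :=
    r.of_sub_of_restrict_mem_relations hE hEσ hvol
  -- (4) `[r|_E] ≡ [r'|_{ψ E}]` by ONE change of variables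
  have hT : Literature.ModelTheory.ExponentialFields.IsSemialgebraic ℚ (ψ '' E) :=
    IsSemialgebraicMapOn.isSemialgebraic_image_holds hψsa hEσ hE
  have hTσ' : ψ '' E ⊆ r'.domain := by
    rw [himg]
    exact image_mono hEσ
  have h₂ : of (r.restrict E hE hEσ) - of (r'.restrict (ψ '' E) hT hTσ') ∈ relations := by
    refine changeOfVariablesRel_subset_relations
      ⟨n, r.restrict E hE hEσ, r'.restrict (ψ '' E) hT hTσ', ψ, ψ', ?_, ?_, ?_, rfl, ?_, rfl⟩
    · exact hψsa.mono hEσ hE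
    · intro w hw
      exact (hψ' w hw.1).mono hEσ
    · exact hψinj.mono hEσ
    · intro w hw
      exact hw.2
  -- (5) `[r'] ≡ [r'|_{ψ E}]`: the complement lies in the null image `ψ (σ ∖ E)`
  have hvol' : volume (r'.domain \ ψ '' E) = 0 := by
    have hsub : r'.domain \ ψ '' E ⊆ ψ '' (r.domain \ E) := by
      rintro y ⟨hy, hyE⟩
      rw [himg] at hy
      obtain ⟨w, hw, rfl⟩ := hy
      exact ⟨w, ⟨hw, fun hwE => hyE ⟨w, hwE, rfl⟩⟩, rfl⟩
    refine measure_mono_null hsub ?_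
    exact aeJacobian_volume_image_null ψ ψ' hψ' (fun _ hw => hw.1)
      (hσm.diff (Literature.ModelTheory.ExponentialFields.IsSemialgebraic.measurableSet_holds hE))
      hvol
  have h₃ : of r' - of (r'.restrict (ψ '' E) hT hTσ') ∈ relations :=
    r'.of_sub_of_restrict_mem_relations hT hTσ' hvol'
  -- (6) combine
  have heq : of r - of r' = (of r - of (r.restrict E hE hEσ)) +
      (of (r.restrict E hE hEσ) - of (r'.restrict (ψ '' E) hT hTσ')) -
      (of r' - of (r'.restrict (ψ '' E) hT hTσ')) := by
    abel
  show of r - of r' ∈ relations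
  rw [heq]
  exact relations.sub_mem (relations.add_mem h₁ h₂) h₃

end Summit.KontsevichZagierPeriods.KontsevichZagierPeriods.BetaCancellationLine

end
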